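/-
Copyright (c) 2026 the pub-hodgecm-mathlib formalisation cell (harness21).  Prover seat hodgecm-mathlib-LH4-p10 (g0), req620 Track A «(D-RAM) FOUR-FRAME» squad
(unit U3_Laws, stubs `stub_U3_stableLaw_RP ∕ _RU`; the (S-fin) line of MEMO-stableLaw-finite (LH4-p10), step (3), brick (3b) «the self-duality fibre is a stabiliser coset»).  2026-09-03.
-/
import Literature.NumberTheory.Automorphic.UnitaryLatticeTreeApartment     -- ★ (B-p14): `dualLatt_eq_self_of_isSelfDualLattice`, `mem_mapGL_iff`; brings ★ `UnitaryLatticeTreeTypes`∕`Dual`∕`Defs`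
import Literature.NumberTheory.Automorphic.UnitaryLatticeTreeStabilizer    -- ★ `mapGL_latt_eq_latt_iff` (the stabiliser test)
import Literature.NumberTheory.Automorphic.UnitaryLatticeTreeTypeTwoGram   -- ★ `isIntMatrix_mul`, `v_det_eq_one_of_isIntMatrix_inv`
import HarnessLib

/-!
# Crux `H413`, line LH4 «(D-RAM) FOUR-FRAME» road — unit U3_Laws (iii), TIER 2 SUPPORT: THE SELF-DUALITY FIBRE OF A LATTICE OVER THE DIAGONAL FORMS IS A STABILISER COSET
# (step (3), brick (3b) of the finite reformulation (S-fin) of the STABLE LAW: for a lattice `M`, the σ-fixed diagonal forms `h_D` with `M` self-dual form ∅ or `D₀·Stab(M)`)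

Cell `hodgecm-mathlib` (D-0151), FLOOR 0, crux item H413 = `stmt-HodgeConjecture-24833`, route of record `HCCMUnconditional`; squad F0∕P3c∕LH4 (req618∕req620).  THEOREMS ONLY
(no `def`, no instance, no notation, no `sorry`, default heartbeats); lane `--supports stmt-HodgeConjecture-24833 --as helper` (count-neutral).  Diagonal-model currency of ★ p855032 ∕
p855115 ∕ p855240 (forms `diag(D)`, `D` σ-fixed) — the signature posted on `F0/P3c/LH4/STATUS.md` 2026-09-03 22:24Z (LH4-p10).

WHAT IS PROVED.  (i) `mapGL_diagonal_div_eq_of_isVertexLattice_zero_diagonal`: if a lattice `M ⊆ K³` is SELF-DUAL (type `0`) for two diagonal forms `diag(d)` and `diag(d′)` with non-zero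
entries (`σ` valuation-preserving), then the diagonal matrix `diag(d_i ∕ d′_i)` STABILISES `M`.  (ii) `isVertexLattice_zero_diagonal_mul_of_mapGL_diagonal_eq`: conversely, if `M` is
self-dual for `diag(d)` and a diagonal `diag(u)` with UNIT entries stabilises `M`, then `M` is self-dual for `diag(d·u)`.  So for a fixed lattice `M` the set
`F₀(M) = {D : M is self-dual for diag(D)}` (inside the σ-fixed unit diagonals `𝒰`) is EMPTY OR ONE COSET `D₀·Stab_𝒰(M)` — the «fibre» of step (3) of (S-fin) (MEMO-stableLaw-finite
§2 (3)(c), LH4-p10 (g0) 2026-09-03): it is what turns the eight-class sum `Σ_s C_0(s)` (★ p855115 ∕ p855240's binder (MS)) into the weighted count `Σ_{M ∈ 𝓛₀} 1∕[𝒰 : Stab_𝒰(M)]`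
over the `T`-stable normalised lattices `𝓛₀` (★ p855216 HNF stability enumerates them).
THE MATHEMATICS ([Jacobowitz1962, §4, §7]; [Serre1980Trees, II §1.1]).  The dual for `diag(d′)` is `{y : ∀ m ∈ M, Σ σ(m_i) d′_i y_i ∈ 𝒪} = diag(d∕d′)·(dual for diag(d))`
(`pairing_diagonal`, `dualLatt_diagonal_eq_mapGL`); a type-0 vertex equals its dual (★ `dualLatt_eq_self_of_isSelfDualLattice`), so `M = diag(d∕d′)·M`.  Conversely with `M = g·𝒪³`:
`Gram_{d·u}(g) = Gram_d(g)·(g⁻¹ diag(u) g)` and `g⁻¹ diag(u) g ∈ GL₃(𝒪)` exactly when `diag(u)·M = M` (★ `mapGL_latt_eq_latt_iff`), so integrality, `ϖ·Gram⁻¹` integrality and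
`|det| = 1` transfer.
* §1 `pairing_diagonal` (`⟨x, y⟩_{diag d} = Σ σ(x_i) d_i y_i`), `coe_inv_diagonal` (the inverse of a diagonal `GL₃` element), `dualLatt_diagonal_eq_mapGL` (dual for `diag d′` = `diag(d∕d′)`·dual for `diag d`).
* §2 heads (i) and (ii) (★ `v_det_eq_one_of_isIntMatrix_inv` for the unit determinant of `g⁻¹ diag(u) g`).
HONEST LABEL.  Count-neutral (`--supports`); nothing printed is asserted; the census laws stay PROVER TARGETS; the verdict of record for (D-RAM) stays PRINT
[LanglandsShelstad1989 Thm. p. 484 ∕ Rogawski1990 Prop. 4.9.1 (a)] ∕ XL; `HC_CM` is proved only modulo the 7 printed citations (2 remaining named inputs: hLiu418 =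
`stmt-HodgeConjecture-24832`, h413 = `stmt-HodgeConjecture-24833`) until rung 0 closes.

## References
* [Jacobowitz1962] R. Jacobowitz, *Hermitian forms over local fields*, Amer. J. Math. 84 (1962), §4 (Gram matrices and duals under a change of form), §7 (unimodular lattices).
* [Serre1980Trees] J.-P. Serre, *Trees* (1980), Ch. II §1.1 (lattices `g·𝒪^N`, the stabiliser `GL_N(𝒪)`).
* [Kottwitz1986BaseChangeUnits] R. E. Kottwitz, *Base change for unit elements of Hecke algebras*, Compositio Math. 60 (1986), §1 pp. 240–241 (fixed-lattice counting).
-/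

set_option autoImplicit false

noncomputable section

namespace Summit.HodgeConjecture.HodgeConjecture.Cruxes.H413.F0P3cDyRamDiagonalSelfDualFibre

open Matrix
open Literature.NumberTheory.Automorphic Literature.NumberTheory.Automorphic.HermitianLattice Literature.NumberTheory.Automorphic.UnitaryGroup
open Literature.NumberTheory.Automorphic.UnitaryLatticeTree
open scoped Valued WithZero Matrix MatrixGroups

variable {K : Type*} [Field K]

/-! ## §1  The pairing of a diagonal form; duals for two diagonal forms -/

/-- `⟨x, y⟩_{diag(d)} = Σ_i σ(x_i)·d_i·y_i`. [cite: Jacobowitz1962, §4] -/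
theorem pairing_diagonal (σ : K →+* K) (d x y : Fin 3 → K) :
    pairing σ (Matrix.diagonal d) x y = ∑ i, σ (x i) * d i * y i := by
  rw [pairing_apply]
  refine Finset.sum_congr rfl fun i _ => ?_
  rw [Finset.sum_eq_single i (fun j _ hj => by rw [Matrix.diagonal_apply_ne _ (Ne.symm hj), mul_zero, zero_mul]) (fun h => absurd (Finset.mem_univ i) h),
    Matrix.diagonal_apply_eq]

/-- The inverse of a diagonal `GL₃` element with non-zero entries is the diagonal of the inverses. [cite: Serre1980Trees, II §1.1] -/
theorem coe_inv_diagonal {w : Fin 3 → K} (hw : ∀ i, w i ≠ 0) (U : GL (Fin 3) K) (hU : (U : Matrix (Fin 3) (Fin 3) K) = Matrix.diagonal w) :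
    ((U⁻¹ : GL (Fin 3) K) : Matrix (Fin 3) (Fin 3) K) = Matrix.diagonal fun i => (w i)⁻¹ := by
  rw [Matrix.coe_units_inv, hU]
  refine Matrix.inv_eq_left_inv ?_
  rw [Matrix.diagonal_mul_diagonal, ← Matrix.diagonal_one]
  congr 1; funext i; exact inv_mul_cancel₀ (hw i)

section Valued

variable [Valued K ℤᵐ⁰]

/-- **DUALS FOR TWO DIAGONAL FORMS**: the dual of `M` for `diag(d′)` is `diag(d∕d′)` applied to the dual of `M` for `diag(d)` (`d_i, d′_i ≠ 0`):
`y ∈ M^{♯_{d′}} ⟺ diag(d′∕d)·y ∈ M^{♯_d}`, since `⟨m, y⟩_{d′} = ⟨m, diag(d′∕d) y⟩_d`. [cite: Jacobowitz1962, §4] -/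
theorem dualLatt_diagonal_eq_mapGL (σ : K →+* K) {d d' : Fin 3 → K} (hd : ∀ i, d i ≠ 0) (hd' : ∀ i, d' i ≠ 0) (M : Submodule 𝒪[K] (Fin 3 → K))
    (U : GL (Fin 3) K) (hU : (U : Matrix (Fin 3) (Fin 3) K) = Matrix.diagonal fun i => d i / d' i) :
    dualLatt σ (Matrix.diagonal d') M = mapGL U (dualLatt σ (Matrix.diagonal d) M) := by
  have hw : ∀ i, d i / d' i ≠ 0 := fun i => div_ne_zero (hd i) (hd' i)
  have hUinv := coe_inv_diagonal hw U hU
  ext y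
  rw [mem_mapGL_iff, mem_dualLatt, mem_dualLatt, hUinv]
  refine forall₂_congr fun m _ => ?_
  rw [pairing_diagonal, pairing_diagonal]
  have hterm : ∀ i, σ (m i) * d i * ((Matrix.diagonal fun i => (d i / d' i)⁻¹).mulVec y i) = σ (m i) * d' i * y i := fun i => by
    rw [Matrix.mulVec_diagonal, inv_div]
    field_simp [hd i, hd' i]
  rw [Finset.sum_congr rfl fun i _ => hterm i]

/-! ## §2  The fibre is a stabiliser coset -/

/-- **(i) TWO FORMS, ONE SELF-DUAL LATTICE ⇒ THE QUOTIENT STABILISES.**  If `M` is a type-`0` (self-dual) vertex lattice for BOTH `diag(d)` and `diag(d′)` (non-zero entries,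
`σ` valuation-preserving), then `diag(d_i∕d′_i)·M = M`: `M = M^{♯_{d′}} = diag(d∕d′)·M^{♯_d} = diag(d∕d′)·M`. [cite: Jacobowitz1962, §4, §7] [cite: Serre1980Trees, II §1.1] -/
theorem mapGL_diagonal_div_eq_of_isVertexLattice_zero_diagonal {σ : K →+* K} (hvσ : ∀ a, Valued.v (σ a) = Valued.v a) {ϖ : K}
    {d d' : Fin 3 → K} (hd : ∀ i, d i ≠ 0) (hd' : ∀ i, d' i ≠ 0) {M : Submodule 𝒪[K] (Fin 3 → K)}
    (hM : IsVertexLattice σ ϖ (Matrix.diagonal d) 0 M) (hM' : IsVertexLattice σ ϖ (Matrix.diagonal d') 0 M)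
    (U : GL (Fin 3) K) (hU : (U : Matrix (Fin 3) (Fin 3) K) = Matrix.diagonal fun i => d i / d' i) : mapGL U M = M := by
  have hH : IsUnit (Matrix.diagonal d).det := by
    rw [Matrix.det_diagonal, isUnit_iff_ne_zero]; exact Finset.prod_ne_zero_iff.2 fun i _ => hd i
  have hH' : IsUnit (Matrix.diagonal d').det := by
    rw [Matrix.det_diagonal, isUnit_iff_ne_zero]; exact Finset.prod_ne_zero_iff.2 fun i _ => hd' i
  have h1 : dualLatt σ (Matrix.diagonal d) M = M := dualLatt_eq_self_of_isSelfDualLattice hvσ hH hM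
  have h2 : dualLatt σ (Matrix.diagonal d') M = M := dualLatt_eq_self_of_isSelfDualLattice hvσ hH' hM'
  have h3 := dualLatt_diagonal_eq_mapGL σ hd hd' M U hU
  rw [h1, h2] at h3
  exact h3.symm

/-- **(ii) A UNIT DIAGONAL STABILISER MOVES THE FORM.**  If `M` is a type-`0` vertex lattice for `diag(d)` and `diag(u)·M = M` with `|u_i| = 1`, then `M` is a type-`0` vertex
lattice for `diag(d_i·u_i)`: with `M = g·𝒪³`, `Gram_{d·u}(g) = Gram_d(g)·(g⁻¹ diag(u) g)` and `g⁻¹ diag(u) g ∈ GL₃(𝒪)` (★ `mapGL_latt_eq_latt_iff`).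
[cite: Jacobowitz1962, §4, §7] [cite: Serre1980Trees, II §1.1] [cite: Kottwitz1986BaseChangeUnits, §1 pp. 240–241] -/
theorem isVertexLattice_zero_diagonal_mul_of_mapGL_diagonal_eq {σ : K →+* K} {ϖ : K} {d : Fin 3 → K} {u : Fin 3 → K}
    {M : Submodule 𝒪[K] (Fin 3 → K)} (hM : IsVertexLattice σ ϖ (Matrix.diagonal d) 0 M)
    (U : GL (Fin 3) K) (hU : (U : Matrix (Fin 3) (Fin 3) K) = Matrix.diagonal u) (hfix : mapGL U M = M) :
    IsVertexLattice σ ϖ (Matrix.diagonal fun i => d i * u i) 0 M := by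
  obtain ⟨g, rfl, hG, hG', hdet⟩ := hM
  obtain ⟨hk, hk'⟩ := (mapGL_latt_eq_latt_iff U g).1 hfix
  set k : GL (Fin 3) K := g⁻¹ * U * g with hk_def
  have hkinv : (g⁻¹ * U⁻¹ * g : GL (Fin 3) K) = k⁻¹ := by rw [hk_def]; group
  rw [hkinv] at hk'
  -- the new Gram matrix is the old one times `k`
  have hgram : formCongr σ g (Matrix.diagonal fun i => d i * u i) = formCongr σ g (Matrix.diagonal d) * (k : Matrix (Fin 3) (Fin 3) K) := by
    have hdiag : (Matrix.diagonal fun i => d i * u i : Matrix (Fin 3) (Fin 3) K) = Matrix.diagonal d * (U : Matrix (Fin 3) (Fin 3) K) := by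
      rw [hU, Matrix.diagonal_mul_diagonal]
    simp only [hk_def, Units.val_mul, formCongr, hdiag, Matrix.mul_assoc, Units.mul_inv_cancel_left]
  have hdetk : Valued.v (k : Matrix (Fin 3) (Fin 3) K).det = 1 := v_det_eq_one_of_isIntMatrix_inv hk hk'
  refine ⟨g, rfl, ?_, ?_, ?_⟩
  · rw [hgram]; exact isIntMatrix_mul hG hk
  · rw [hgram, Matrix.mul_inv_rev, ← Matrix.coe_units_inv, ← Matrix.mul_smul]
    exact isIntMatrix_mul hk' hG'
  · rw [hgram, Matrix.det_mul, map_mul, hdet, hdetk, mul_one]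

end Valued

end Summit.HodgeConjecture.HodgeConjecture.Cruxes.H413.F0P3cDyRamDiagonalSelfDualFibre

end
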